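import Mathlib
import Summits.AtomisticToContinuum.Crystallization.Theorems.GappedShellCensusCleanLimitsHaveWindowsLayeredStepUp

/-!
# Exactly layered shells ⇒ exactly layered set, file 6: one layer down, and the slab above it is exact

Crux `GappedShellCensus.CleanLimitsHaveWindows` (stmt-AtomisticToContinuum-15932), line `Sketch`, support for
`stub_layeredOfExactShells`.  Anchor `stub_layerStepDown`: below a complete layer `(L, z)` of a set `Z` with the gap
clause and exact bond shells there is a complete layer `(L ± 1, z - h)`, `0.78a ≤ h ≤ 0.85a`, and the only points of
`Z` with height in `[z - h, z)` are the sites of that lower layer.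

Proof.  `stub_layerCaps` at `(L, z)` gives the complete lower layer `(L + ε⁻, z - h⁻)`; `stub_layerCaps` at the lower
layer gives its caps, and its upper cap height is `h⁻` because the site `(0, 0)` of the layer `(L, z)` is a
bond-shell point of the site `(0, 0)` of the lower layer at relative height `h⁻ > 0`; conclude by `slab_exact` at the
lower layer.
-/

noncomputable section

namespace Summit.AtomisticToContinuum.Crystallization.Theorems.CleanHull

open Literature.MathematicalPhysics.StatisticalMechanics

/-- **Layer step, downwards.** Below a complete layer `(L, z)` (spacing `a'` in the band) of a set `Z` with the gap
clause all of whose bond shells are exact slot models there is a complete layer `(L + ε, z - h)`, `ε = ±1`,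
`39a/50 ≤ h ≤ 17a/20`, and every point of `Z` with height in `[z - h, z)` is a site of the layer `(L + ε, z - h)`.
[folklore] -/
theorem stub_layerStepDown (Z : Set (EuclideanSpace ℝ (Fin 3))) (a : ℝ) (ha : 0 < a)
    (hgap : ∀ y ∈ Z, ∀ w ∈ Z, w ≠ y → a * (1 - 1 / 50) ≤ dist y w ∧
      (dist y w ≤ a * (1 + 1 / 50) ∨ a * (63 / 50) ≤ dist y w))
    (hexact : ∀ p ∈ Z, ∃ (a' hp' hm' : ℝ) (A : EuclideanSpace ℝ (Fin 3) →ₗᵢ[ℝ] EuclideanSpace ℝ (Fin 3)),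
      0 < a' ∧ 0 < hp' ∧ 0 < hm' ∧
      ((bondShell a Z p = Set.range fun k : Fin 12 => p + A (slotC a' hp' hm' k)) ∨
       (bondShell a Z p = Set.range fun k : Fin 12 => p + A (slotH a' hp' hm' k))))
    (p₀ : EuclideanSpace ℝ (Fin 3)) (a' : ℝ) (A : EuclideanSpace ℝ (Fin 3) →ₗᵢ[ℝ] EuclideanSpace ℝ (Fin 3))
    (hlo : a * (1 - 1 / 50) ≤ a') (hhi : a' ≤ a * (1 + 1 / 50)) (L : ℤ) (z : ℝ)
    (hlayer : ∀ i j : ℤ, A (((i : ℝ) • triangularVec₁ a') + ((j : ℝ) • triangularVec₂ a') +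
      ((L : ℝ) • barlowOffset a') + (z • layerNormal 1)) + p₀ ∈ Z) :
    ∃ (ε : ℤ) (h : ℝ), (ε = 1 ∨ ε = -1) ∧ 39 / 50 * a ≤ h ∧ h ≤ 17 / 20 * a ∧
      (∀ i j : ℤ, A (((i : ℝ) • triangularVec₁ a') + ((j : ℝ) • triangularVec₂ a') +
        (((L + ε : ℤ) : ℝ) • barlowOffset a') + ((z - h) • layerNormal 1)) + p₀ ∈ Z) ∧
      (∀ x ∈ Z, z - h ≤ inner ℝ (x - p₀) (A (layerNormal 1)) → inner ℝ (x - p₀) (A (layerNormal 1)) < z →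
        ∃ i j : ℤ, x = A (((i : ℝ) • triangularVec₁ a') + ((j : ℝ) • triangularVec₂ a') +
          (((L + ε : ℤ) : ℝ) • barlowOffset a') + ((z - h) • layerNormal 1)) + p₀) := by
  have ha' : 0 < a' := lt_of_lt_of_le (by positivity) hlo
  obtain ⟨εp, εm, hp, hm, -, hεm, -, hmpos, -, -, b3, b4, -, hdown, -⟩ :=
    stub_layerCaps Z a ha hgap hexact p₀ a' A hlo hhi L z hlayer
  obtain ⟨hmlo, hmhi⟩ := cap_height_bounds ha hmpos hlo hhi b3 b4
  -- caps of the lower layer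
  obtain ⟨εp', εm', hp', hm', -, -, hpos', hmpos', -, -, -, -, hup', -, H0'⟩ :=
    stub_layerCaps Z a ha hgap hexact p₀ a' A hlo hhi (L + εm) (z - hm) hdown
  -- its upper cap height is `h⁻`: the site `(0,0)` of the layer is a bond-shell point of the site `(0,0)` below
  have hw : barlowOffset a' = (1 / 3 : ℝ) • (triangularVec₁ a' + triangularVec₂ a') := by
    rw [← three_smul_barlowOffset, smul_smul]; norm_num
  have hε2 : (εm : ℝ) ^ 2 = 1 := by rcases hεm with rfl | rfl <;> norm_num
  have hpm : hp' = hm := by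
    have h00 := hlayer 0 0
    have l00 := hdown 0 0
    have hdiff : ((((0 : ℤ) : ℝ) • triangularVec₁ a') + (((0 : ℤ) : ℝ) • triangularVec₂ a') +
        ((L : ℝ) • barlowOffset a') + (z • layerNormal 1)) -
        ((((0 : ℤ) : ℝ) • triangularVec₁ a') + (((0 : ℤ) : ℝ) • triangularVec₂ a') +
          (((L + εm : ℤ) : ℝ) • barlowOffset a') + ((z - hm) • layerNormal 1)) =
        (-(εm : ℝ) / 3) • triangularVec₁ a' + (-(εm : ℝ) / 3) • triangularVec₂ a' + hm • layerNormal 1 := by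
      rw [hw]; push_cast; module
    have hmem : A ((((0 : ℤ) : ℝ) • triangularVec₁ a') + (((0 : ℤ) : ℝ) • triangularVec₂ a') +
        ((L : ℝ) • barlowOffset a') + (z • layerNormal 1)) + p₀ ∈
        bondShell a Z (A ((((0 : ℤ) : ℝ) • triangularVec₁ a') + (((0 : ℤ) : ℝ) • triangularVec₂ a') +
          (((L + εm : ℤ) : ℝ) • barlowOffset a') + ((z - hm) • layerNormal 1)) + p₀) := by
      refine ⟨h00, fun h => ?_, ?_⟩
      · have := congrArg (fun v => inner ℝ (v - p₀) (A (layerNormal 1))) h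
        simp only [add_sub_cancel_right, A.inner_map_map, inner_layerVec_layerNormal] at this
        linarith
      · rw [dist_comm, dist_add_right, A.dist_map, dist_eq_norm, hdiff]
        refine (pow_le_pow_iff_left₀ (norm_nonneg _) (by positivity) two_ne_zero).1 ?_
        rw [la_norm_sq]
        nlinarith [hε2]
    rcases H0' 0 0 _ hmem with ⟨h, -⟩ | h | h <;>
      rw [add_sub_cancel_right, A.inner_map_map, inner_layerVec_layerNormal] at h <;> linarith
  subst hpm
  refine ⟨εm, hp', hεm, hmlo, hmhi, hdown, fun x hx h1 h2 => ?_⟩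
  exact slab_exact Z a ha hgap hexact p₀ a' A hlo hhi (L + εm) (z - hp') εp' hp' hm' hpos' hmpos' hmhi hup' H0'
    x hx h1 (by linarith)

end Summit.AtomisticToContinuum.Crystallization.Theorems.CleanHull

end
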